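import Mathlib.Analysis.InnerProductSpace.PiL2
import Mathlib.Analysis.Calculus.FDeriv.Prod
import Mathlib.Analysis.Calculus.FDeriv.Add
import Mathlib.Analysis.Calculus.FDeriv.Mul
import Mathlib.Analysis.Calculus.FDeriv.Comp
import Mathlib.Analysis.Calculus.Deriv.Comp
import Mathlib.Analysis.Calculus.Deriv.Add
import Mathlib.Analysis.Calculus.Deriv.Mul
import Mathlib.Analysis.Calculus.Deriv.Prod
import Mathlib.Analysis.Calculus.Deriv.Inv
import HarnessLib

/-!
# Eulerian pullback kinematics in the plane (method of characteristics, Eulerian form)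

Topic `Literature/Analysis/FluidPDE`. Infrastructure for EXPLICIT smooth solutions of the planar
transport equation `∂ₜΘ + DΘ[V] = 0` with divergence-free `V`, in the pointwise form used by the
quasi-self-similar mixing cluster (`QuasiSelfSimilar.IsCompatibleBlockSystem`,
`QuasiSelfSimilarCompatibleBlocks.lean`: transport as
`deriv (fun s => Θ s z) t + fderiv ℝ (Θ t) z (V t z) = 0`, incompressibility as
`∑ j, fderiv ℝ (V t) z (EuclideanSpace.single j 1) j = 0`).

The point of view (folklore; it is the Eulerian reading of the method of characteristics, and the
form in which Alberti–Crippa–Mazzucato, JAMS 32 (2019), §§7–8 and Bruè–De Lellis, CMP 400 (2023),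
§4 *use* their building blocks): a scalar is moved by prescribing a **material-coordinate map**
`Ψ : ℝ → ℝ² → ℝ²` (the pullback / inverse flow map, `Ψ(0,·) = id`) together with a velocity `V`
satisfying the **pullback identity** `∂ₜΨ + D_zΨ[V] = 0`; then `Θ := Θ_ref ∘ Ψ` solves the
transport equation (chain rule, `transport_comp_of_pullback`), with no flow ODE, no inverse
function theorem and no bijectivity anywhere. This file provides

* coordinates on `E² = EuclideanSpace ℝ (Fin 2)`: `vec2 a b = (a, b)`, the derivative of a
  function given through a function of two real variables (`hasFDerivAt_coordFun`), derivatives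
  and divergence of a field given by two component functions (`hasFDerivAt_vec2`,
  `divergence_vec2` : `div (P, Q) = ∂₀P + ∂₁Q`), whence stream-function fields `(∂₁ψ, -∂₀ψ)` are
  divergence free as soon as the mixed partials agree (`divergence_vec2_eq_zero_of_mixed`);
* the transport expression `∂ₜΦ(t,z) + D_zΦ(t,z)[V(t,z)]` under: composition with a pullback
  (`transport_comp_of_pullback`, `transport_comp_of_eventually_static`), a move that has not
  started (`transportExpr_comp_of_eventually_id`), local vanishing
  (`transportExpr_eq_zero_of_eventually_eq_zero`), a static field (`transportExpr_eq_zero_of_static`),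
  smooth time reparametrisation by a clock `σ` (`transportExpr_reparam`: `(Φ∘σ, σ'·V∘σ)`), and
  composition of moves acting at different times (`pullback_comp_of_eventually_static`,
  `pullback_comp_of_inner_static`);
* the two explicit primitive moves, each given as (pullback map, Eulerian velocity) in closed
  form with its pullback identity and incompressibility checked directly:
  **shears** `Ψ = (x - φ(t,y), y)`, `V = (∂ₜφ, 0)` (`hShear_pullback_identity`,
  `divergence_hShearVelocity`, and the vertical versions), and **axial stretches**
  `Ψ = (Ξ(t,x), c + (y-c)/∂ₓΞ)`, `V = (g, -(y-c)∂ₓg)`, `g = -∂ₜΞ/∂ₓΞ` (`axial_pullback_identity`,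
  `divergence_axialVelocity`) — the move behind the gate squeeze of the quasi-self-similar blocks
  (a channel thinned by `λ(t)` near a face while stretched along its axis) and, for affine
  `Ξ(t,·)`, the local hyperbolic squeeze.

Localised moves are obtained by multiplying the stream function by cut-offs (the field stays
smooth and divergence free by `divergence_vec2_eq_zero_of_mixed`; the pullback identity then
holds where the cut-offs are `≡ 1`, and the transported profile has to vanish near the rest);
a smooth ramp from which all explicit profiles (shear displacements, the maps `Ξ`, cut-offs)
can be built as affine pieces with smooth corners — `P = 0` on `(-∞,-1]`, `P(s) = s` on
`[1,∞)`, `0 ≤ P' ≤ 1` — is `Literature.Topology.FourManifolds.SmoothMax.exists_smoothPosPart`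
(`Literature/Topology/FourManifolds/SmoothMax.lean`; with it every profile is exactly affine with
known data off its transition intervals, and no quantitative derivative bound on
`Real.smoothTransition` is ever needed). Deliberately NOT here: flows of ODEs, the
general cofactor formula `V = -adj(D_zΨ) ∂ₜΨ` (for the primitives the identity is a direct
computation), anything measure-theoretic.

## Why this file exists

`Literature.Analysis.FluidPDE.acm_compatible_blocks` (`QuasiSelfSimilarCompatibleBlocks.lean`) is
the one undischarged fact behind Bruè–De Lellis, Thm. 4.1 in the tree
(`alberti_crippa_mazzucato_planar_family`, `alberti_crippa_mazzucato_family`,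
`acm_building_blocks`, and through them the anomalous-dissipation facts): a discharge has to
exhibit explicit smooth incompressible isotopies of the unit square realising the Peano-snake
moves that Alberti–Crippa–Mazzucato give by figures (arXiv:1605.02090, §8.9–8.11). In the
pullback form every clause of `QuasiSelfSimilar.IsCompatibleBlockSystem` about transport,
incompressibility, the bound `|Θ| ≤ 10` and self-similarity at `t = 1` becomes a pointwise
identity between explicit maps. This file is that calculus layer; it states no named fact.

## References

* G. Alberti, G. Crippa, A. L. Mazzucato, *Exponential self-similar mixing by incompressible
  flows*, J. Amer. Math. Soc. 32 (2019), 445–490, §§7–8 (arXiv:1605.02090).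
* E. Bruè, C. De Lellis, *Anomalous dissipation for the forced 3D Navier–Stokes equations*,
  Comm. Math. Phys. 400 (2023), 1507–1533, §4 (arXiv:2207.06301).
-/

noncomputable section

open Function Set Filter
open scoped Topology

namespace Literature.Analysis.FluidPDE

namespace PlanarKinematics

/-- The plane `ℝ²` as a Euclidean space (the ambient space of the quasi-self-similar blocks).
[folklore] -/
local notation "E²" => EuclideanSpace ℝ (Fin 2)

variable {G : Type*} [NormedAddCommGroup G] [NormedSpace ℝ G]

/-! ## Coordinates -/

/-- The vector `(a, b) ∈ ℝ²`, written on the standard basis: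
`vec2 a b = a • e₀ + b • e₁`. [folklore] -/
def vec2 (a b : ℝ) : E² := a • EuclideanSpace.single 0 1 + b • EuclideanSpace.single 1 1

/-- First coordinate of `vec2`. [folklore] -/
@[simp]
theorem vec2_apply_zero (a b : ℝ) : vec2 a b 0 = a := by
  simp [vec2]

/-- Second coordinate of `vec2`. [folklore] -/
@[simp]
theorem vec2_apply_one (a b : ℝ) : vec2 a b 1 = b := by
  simp [vec2]

/-- Every vector of `ℝ²` is `vec2` of its coordinates. [folklore] -/
theorem vec2_apply_eq (z : E²) : vec2 (z 0) (z 1) = z := by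
  ext j
  fin_cases j <;> simp

/-- Two `vec2`s are equal iff their coordinates are. [folklore] -/
theorem vec2_eq_vec2_iff {a b a' b' : ℝ} : vec2 a b = vec2 a' b' ↔ a = a' ∧ b = b' := by
  constructor
  · intro h
    exact ⟨by simpa using congrArg (fun v : E² => v 0) h, by simpa using congrArg (fun v : E² => v 1) h⟩
  · rintro ⟨rfl, rfl⟩; rfl

/-- `vec2 a b = 0` iff both coordinates vanish. [folklore] -/
theorem vec2_eq_zero_iff {a b : ℝ} : vec2 a b = 0 ↔ a = 0 ∧ b = 0 := by
  have h0 : (0 : E²) = vec2 0 0 := by ext j; fin_cases j <;> simp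
  rw [h0, vec2_eq_vec2_iff]

/-- `vec2` is additive. [folklore] -/
theorem vec2_add_vec2 (a b a' b' : ℝ) : vec2 a b + vec2 a' b' = vec2 (a + a') (b + b') := by
  ext j; fin_cases j <;> simp

/-- Scalar multiples of `vec2`. [folklore] -/
theorem smul_vec2 (c a b : ℝ) : c • vec2 a b = vec2 (c * a) (c * b) := by
  ext j; fin_cases j <;> simp

/-- The coordinate map `ℝ² → ℝ × ℝ` as a continuous linear map. [folklore] -/
def coords : E² →L[ℝ] ℝ × ℝ :=
  (EuclideanSpace.proj (0 : Fin 2)).prod (EuclideanSpace.proj (1 : Fin 2))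

/-- The coordinate map evaluates to the pair of coordinates. [folklore] -/
@[simp]
theorem coords_apply (z : E²) : coords z = (z 0, z 1) := rfl

/-- **Total derivative from partial derivatives** (two real variables): if `g(x,y)` is
(Fréchet) differentiable at `(x,y)` with partial derivatives `gx`, `gy` there, its derivative is
`(a,b) ↦ gx·a + gy·b`. [folklore] -/
theorem hasFDerivAt_uncurry_of_partial {g : ℝ → ℝ → ℝ} {x y gx gy : ℝ}
    (hg : DifferentiableAt ℝ (uncurry g) (x, y))
    (hx : HasDerivAt (fun a => g a y) gx x) (hy : HasDerivAt (fun b => g x b) gy y) :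
    HasFDerivAt (uncurry g)
      (gx • ContinuousLinearMap.fst ℝ ℝ ℝ + gy • ContinuousLinearMap.snd ℝ ℝ ℝ) (x, y) := by
  set L := fderiv ℝ (uncurry g) (x, y) with hL
  have hgL : HasFDerivAt (uncurry g) L (x, y) := hg.hasFDerivAt
  -- the partial derivatives are the values of `L` on the axes
  have h1 : HasDerivAt (fun a => uncurry g (a, y)) (L (1, 0)) x := by
    have hl : HasDerivAt (fun a : ℝ => (a, y)) (1, 0) x := (hasDerivAt_id x).prodMk (hasDerivAt_const x y)
    exact hgL.comp_hasDerivAt x hl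
  have h2 : HasDerivAt (fun b => uncurry g (x, b)) (L (0, 1)) y := by
    have hl : HasDerivAt (fun b : ℝ => (x, b)) (0, 1) y := (hasDerivAt_const y x).prodMk (hasDerivAt_id y)
    exact hgL.comp_hasDerivAt y hl
  have e1 : L (1, 0) = gx := h1.unique hx
  have e2 : L (0, 1) = gy := h2.unique hy
  have key : ∀ a b : ℝ, L (a, b) = gx * a + gy * b := by
    intro a b
    have hab : ((a, b) : ℝ × ℝ) = a • ((1 : ℝ), (0 : ℝ)) + b • ((0 : ℝ), (1 : ℝ)) := by ext <;> simp
    rw [hab, map_add, map_smul, map_smul, e1, e2, smul_eq_mul, smul_eq_mul]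
    ring
  have hLeq : L = gx • ContinuousLinearMap.fst ℝ ℝ ℝ + gy • ContinuousLinearMap.snd ℝ ℝ ℝ := by
    refine ContinuousLinearMap.ext fun v => ?_
    obtain ⟨a, b⟩ := v
    rw [key]
    simp
  rw [hLeq] at hgL
  exact hgL

/-- **Derivative of a function of the two coordinates**: for `w ↦ g(w₀, w₁)` on `ℝ²`, with `g`
differentiable at `(z₀, z₁)` and partials `gx`, `gy` there, the derivative is
`v ↦ gx·v₀ + gy·v₁`. [folklore] -/
theorem hasFDerivAt_coordFun {g : ℝ → ℝ → ℝ} {z : E²} {gx gy : ℝ}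
    (hg : DifferentiableAt ℝ (uncurry g) (z 0, z 1))
    (hx : HasDerivAt (fun a => g a (z 1)) gx (z 0)) (hy : HasDerivAt (fun b => g (z 0) b) gy (z 1)) :
    HasFDerivAt (fun w : E² => g (w 0) (w 1))
      (gx • (EuclideanSpace.proj (0 : Fin 2) : E² →L[ℝ] ℝ) +
        gy • (EuclideanSpace.proj (1 : Fin 2) : E² →L[ℝ] ℝ)) z := by
  have h0 := (hasFDerivAt_uncurry_of_partial hg hx hy).comp z coords.hasFDerivAt
  have h : HasFDerivAt (fun w : E² => g (w 0) (w 1))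
      ((gx • ContinuousLinearMap.fst ℝ ℝ ℝ + gy • ContinuousLinearMap.snd ℝ ℝ ℝ).comp coords) z :=
    h0
  have hder : (gx • ContinuousLinearMap.fst ℝ ℝ ℝ + gy • ContinuousLinearMap.snd ℝ ℝ ℝ).comp coords =
      gx • (EuclideanSpace.proj (0 : Fin 2) : E² →L[ℝ] ℝ) +
        gy • (EuclideanSpace.proj (1 : Fin 2) : E² →L[ℝ] ℝ) := by
    ext v
    simp [coords]
  rw [← hder]
  exact h

/-- The value of the derivative of `w ↦ g(w₀, w₁)` on a vector `v`: `gx·v₀ + gy·v₁`. [folklore] -/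
theorem fderiv_coordFun_apply {g : ℝ → ℝ → ℝ} {z : E²} {gx gy : ℝ}
    (hg : DifferentiableAt ℝ (uncurry g) (z 0, z 1))
    (hx : HasDerivAt (fun a => g a (z 1)) gx (z 0)) (hy : HasDerivAt (fun b => g (z 0) b) gy (z 1))
    (v : E²) :
    fderiv ℝ (fun w : E² => g (w 0) (w 1)) z v = gx * v 0 + gy * v 1 := by
  rw [(hasFDerivAt_coordFun hg hx hy).fderiv]
  simp

/-! ## Vector fields given by two component functions -/

/-- **Derivative of a planar field from its components**: if `a`, `b : ℝ² → ℝ` have derivatives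
`a'`, `b'` at `z`, then `w ↦ (a w, b w)` has derivative `v ↦ (a' v, b' v)`. [folklore] -/
theorem hasFDerivAt_vec2 {a b : E² → ℝ} {a' b' : E² →L[ℝ] ℝ} {z : E²}
    (ha : HasFDerivAt a a' z) (hb : HasFDerivAt b b' z) :
    HasFDerivAt (fun w => vec2 (a w) (b w))
      (a'.smulRight (EuclideanSpace.single 0 1) + b'.smulRight (EuclideanSpace.single 1 1)) z :=
  (ha.smul_const _).add (hb.smul_const _)

/-- The derivative of `w ↦ (a w, b w)` applied to `v` is `(a' v, b' v)`. [folklore] -/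
theorem fderiv_vec2_apply {a b : E² → ℝ} {a' b' : E² →L[ℝ] ℝ} {z : E²}
    (ha : HasFDerivAt a a' z) (hb : HasFDerivAt b b' z) (v : E²) :
    fderiv ℝ (fun w => vec2 (a w) (b w)) z v = vec2 (a' v) (b' v) := by
  rw [(hasFDerivAt_vec2 ha hb).fderiv]
  simp [vec2]

/-- **Time derivative of a planar curve from its components**: if `a`, `b : ℝ → ℝ` have
derivatives `a'`, `b'` at `t`, then `s ↦ (a s, b s)` has derivative `(a', b')`. [folklore] -/
theorem hasDerivAt_vec2 {a b : ℝ → ℝ} {a' b' t : ℝ}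
    (ha : HasDerivAt a a' t) (hb : HasDerivAt b b' t) :
    HasDerivAt (fun s => vec2 (a s) (b s)) (vec2 a' b') t :=
  (ha.smul_const _).add (hb.smul_const _)

/-- **Divergence of a planar field from its components**: `div (a, b)(z) = a'(e₀) + b'(e₁)`
(`= ∂₀a + ∂₁b`), in the coordinate form `∑ j, D(a,b)(z)[e_j]_j` of the block systems. [folklore] -/
theorem divergence_vec2 {a b : E² → ℝ} {a' b' : E² →L[ℝ] ℝ} {z : E²}
    (ha : HasFDerivAt a a' z) (hb : HasFDerivAt b b' z) :
    ∑ j, fderiv ℝ (fun w => vec2 (a w) (b w)) z (EuclideanSpace.single j 1) j =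
      a' (EuclideanSpace.single 0 1) + b' (EuclideanSpace.single 1 1) := by
  simp_rw [fderiv_vec2_apply ha hb]
  rw [Fin.sum_univ_two, vec2_apply_zero, vec2_apply_one]

/-- **Divergence in terms of partial derivatives**: for a field `(P(w₀,w₁), Q(w₀,w₁))` with `P`, `Q`
differentiable at the point and partials `Px, Py, Qx, Qy` there, `div = Px + Qy`. [folklore] -/
theorem divergence_vec2_coordFun {P Q : ℝ → ℝ → ℝ} {z : E²} {Px Py Qx Qy : ℝ}
    (hP : DifferentiableAt ℝ (uncurry P) (z 0, z 1)) (hQ : DifferentiableAt ℝ (uncurry Q) (z 0, z 1))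
    (hPx : HasDerivAt (fun a => P a (z 1)) Px (z 0)) (hPy : HasDerivAt (fun b => P (z 0) b) Py (z 1))
    (hQx : HasDerivAt (fun a => Q a (z 1)) Qx (z 0)) (hQy : HasDerivAt (fun b => Q (z 0) b) Qy (z 1)) :
    ∑ j, fderiv ℝ (fun w : E² => vec2 (P (w 0) (w 1)) (Q (w 0) (w 1))) z (EuclideanSpace.single j 1) j =
      Px + Qy := by
  rw [divergence_vec2 (hasFDerivAt_coordFun hP hPx hPy) (hasFDerivAt_coordFun hQ hQx hQy)]
  simp

/-- **Stream-function fields are divergence free**: a field `(P, Q) = (∂₁ψ, -∂₀ψ)` has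
`div = ∂₀∂₁ψ - ∂₁∂₀ψ = 0`; in the form consumed here: if `∂ₓP = m` and `∂_yQ = -m` at the point
(equality of the mixed partials of `ψ`), the divergence vanishes. [folklore] -/
theorem divergence_vec2_eq_zero_of_mixed {P Q : ℝ → ℝ → ℝ} {z : E²} {m Py Qx : ℝ}
    (hP : DifferentiableAt ℝ (uncurry P) (z 0, z 1)) (hQ : DifferentiableAt ℝ (uncurry Q) (z 0, z 1))
    (hPx : HasDerivAt (fun a => P a (z 1)) m (z 0)) (hPy : HasDerivAt (fun b => P (z 0) b) Py (z 1))
    (hQx : HasDerivAt (fun a => Q a (z 1)) Qx (z 0)) (hQy : HasDerivAt (fun b => Q (z 0) b) (-m) (z 1)) :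
    ∑ j, fderiv ℝ (fun w : E² => vec2 (P (w 0) (w 1)) (Q (w 0) (w 1))) z (EuclideanSpace.single j 1) j =
      0 := by
  rw [divergence_vec2_coordFun hP hQ hPx hPy hQx hQy, add_neg_cancel]

/-! ## The transport expression `∂ₜΦ + D_zΦ[V]` -/

/-- **Pullback transport** (method of characteristics, Eulerian form): if the material-coordinate
map `Ψ` and the velocity `V` satisfy the pullback identity `∂ₜΨ(t,z) + D_zΨ(t,z)[V(t,z)] = 0`,
then for every profile `Θ_ref` differentiable at `Ψ(t,z)` the composite `Θ_ref ∘ Ψ` satisfies the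
transport equation at `(t,z)`: `∂ₜ(Θ_ref∘Ψ) + D(Θ_ref∘Ψ)[V] = DΘ_ref[∂ₜΨ + DΨ[V]] = 0`. [folklore] -/
theorem transport_comp_of_pullback {Θ : E² → G} {Ψ V : ℝ → E² → E²} {t : ℝ} {z : E²}
    (hΘ : DifferentiableAt ℝ Θ (Ψ t z)) (hΨt : DifferentiableAt ℝ (fun s => Ψ s z) t)
    (hΨz : DifferentiableAt ℝ (Ψ t) z)
    (hid : deriv (fun s => Ψ s z) t + fderiv ℝ (Ψ t) z (V t z) = 0) :
    deriv (fun s => Θ (Ψ s z)) t + fderiv ℝ (fun w => Θ (Ψ t w)) z (V t z) = 0 := by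
  have h1 : deriv (fun s => Θ (Ψ s z)) t = fderiv ℝ Θ (Ψ t z) (deriv (fun s => Ψ s z) t) :=
    (hΘ.hasFDerivAt.comp_hasDerivAt t hΨt.hasDerivAt).deriv
  have h2 : fderiv ℝ (fun w => Θ (Ψ t w)) z = (fderiv ℝ Θ (Ψ t z)).comp (fderiv ℝ (Ψ t) z) :=
    fderiv_comp z hΘ hΨz
  rw [h1, h2, ContinuousLinearMap.comp_apply, ← map_add, hid, map_zero]

/-- **Pullback transport of an eventually static field**: if `Θ₁(s,·) = Θ₁(t,·)` for `s` near
`t` (the previous stage of the evolution has stopped) and `(Ψ, V)` satisfy the pullback identity at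
`(t,z)`, then `(s,z) ↦ Θ₁(s, Ψ(s,z))` satisfies the transport equation at `(t,z)`. This is the
single-formula gluing of consecutive moves. [folklore] -/
theorem transport_comp_of_eventually_static {Θ₁ : ℝ → E² → G} {Ψ V : ℝ → E² → E²} {t : ℝ} {z : E²}
    (hstat : ∀ᶠ s in 𝓝 t, Θ₁ s = Θ₁ t)
    (hΘ : DifferentiableAt ℝ (Θ₁ t) (Ψ t z)) (hΨt : DifferentiableAt ℝ (fun s => Ψ s z) t)
    (hΨz : DifferentiableAt ℝ (Ψ t) z)
    (hid : deriv (fun s => Ψ s z) t + fderiv ℝ (Ψ t) z (V t z) = 0) :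
    deriv (fun s => Θ₁ s (Ψ s z)) t + fderiv ℝ (fun w => Θ₁ t (Ψ t w)) z (V t z) = 0 := by
  have he : (fun s => Θ₁ s (Ψ s z)) =ᶠ[𝓝 t] fun s => Θ₁ t (Ψ s z) :=
    hstat.mono fun s hs => by simp only [hs]
  rw [he.deriv_eq]
  exact transport_comp_of_pullback hΘ hΨt hΨz hid

/-- **A move that has not started is invisible**: if `Ψ(s,·) = id` for `s` near `t`, the transport
expression of `(s,z) ↦ Θ₁(s, Ψ(s,z))` at `(t,z)` is that of `Θ₁` itself. [folklore] -/
theorem transportExpr_comp_of_eventually_id {Θ₁ : ℝ → E² → G} {Ψ : ℝ → E² → E²} (V : ℝ → E² → E²)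
    {t : ℝ} {z : E²} (hΨ : ∀ᶠ s in 𝓝 t, Ψ s = id) :
    deriv (fun s => Θ₁ s (Ψ s z)) t + fderiv ℝ (fun w => Θ₁ t (Ψ t w)) z (V t z) =
      deriv (fun s => Θ₁ s z) t + fderiv ℝ (Θ₁ t) z (V t z) := by
  have he : (fun s => Θ₁ s (Ψ s z)) =ᶠ[𝓝 t] fun s => Θ₁ s z :=
    hΨ.mono fun s hs => by simp only [hs, id_eq]
  have ht : Ψ t = id := hΨ.self_of_nhds
  rw [he.deriv_eq, ht]
  rfl

/-- **Local vanishing**: where `Θ` vanishes in a space-time neighbourhood, its transport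
expression vanishes (both terms are derivatives of the zero function). [folklore] -/
theorem transportExpr_eq_zero_of_eventually_eq_zero {Θ : ℝ → E² → G} (V : ℝ → E² → E²)
    {t : ℝ} {z : E²} (h : ∀ᶠ p in 𝓝 (t, z), Θ p.1 p.2 = 0) :
    deriv (fun s => Θ s z) t + fderiv ℝ (Θ t) z (V t z) = 0 := by
  have ht : Tendsto (fun s : ℝ => (s, z)) (𝓝 t) (𝓝 (t, z)) :=
    tendsto_id.prodMk_nhds tendsto_const_nhds
  have hz : Tendsto (fun w : E² => (t, w)) (𝓝 z) (𝓝 (t, z)) :=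
    tendsto_const_nhds.prodMk_nhds tendsto_id
  have h1 : (fun s => Θ s z) =ᶠ[𝓝 t] fun _ => (0 : G) := (ht.eventually h).mono fun s hs => hs
  have h2 : (Θ t) =ᶠ[𝓝 z] fun _ => (0 : G) := (hz.eventually h).mono fun w hw => hw
  rw [h1.deriv_eq, h2.fderiv_eq]
  simp

/-- **A static field with vanishing velocity**: if `Θ(s,·) = Θ(t,·)` for `s` near `t` and
`V(t,z) = 0`, the transport expression vanishes at `(t,z)`. [folklore] -/
theorem transportExpr_eq_zero_of_static {Θ : ℝ → E² → G} {V : ℝ → E² → E²} {t : ℝ} {z : E²}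
    (hstat : ∀ᶠ s in 𝓝 t, Θ s = Θ t) (hV : V t z = 0) :
    deriv (fun s => Θ s z) t + fderiv ℝ (Θ t) z (V t z) = 0 := by
  have h1 : (fun s => Θ s z) =ᶠ[𝓝 t] fun _ => Θ t z := hstat.mono fun s hs => by simp only [hs]
  rw [h1.deriv_eq, deriv_const, hV, map_zero, add_zero]

/-- **Time reparametrisation by a clock**: if `(Φ, V)` has vanishing transport expression at
`(σ t, z)` and the clock `σ` has derivative `σ'` at `t`, then the reparametrised pair
`(s ↦ Φ(σ s), σ' · V(σ t))` has vanishing transport expression at `(t, z)`. Applied both to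
pullback maps (the pullback identity) and to transported scalars; with a clock that is constant
near the ends of a time slot (`Gluing.step`), moves are switched on and off smoothly. [folklore] -/
theorem transportExpr_reparam {Φ : ℝ → E² → G} {V : ℝ → E² → E²} {σ : ℝ → ℝ} {t σ' : ℝ} {z : E²}
    (hσ : HasDerivAt σ σ' t) (hΦ : DifferentiableAt ℝ (fun s => Φ s z) (σ t))
    (hid : deriv (fun s => Φ s z) (σ t) + fderiv ℝ (Φ (σ t)) z (V (σ t) z) = 0) :
    deriv (fun s => Φ (σ s) z) t + fderiv ℝ (Φ (σ t)) z (σ' • V (σ t) z) = 0 := by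
  have h1 : deriv (fun s => Φ (σ s) z) t = σ' • deriv (fun s => Φ s z) (σ t) :=
    (hΦ.hasDerivAt.scomp t hσ).deriv
  rw [h1, map_smul, ← smul_add, hid, smul_zero]

/-- **Pullback identity of a composite of two moves acting at different times** (the bookkeeping
behind sequential moves): if the outer map `Ψ₁(s,·)` is static near `t` and the inner pair
`(Ψ₂, V)` satisfies the pullback identity at `(t,z)`, then `Ψ₁(s, Ψ₂(s,z))` satisfies it at
`(t,z)` with the same velocity. [folklore] -/
theorem pullback_comp_of_eventually_static {Ψ₁ Ψ₂ V : ℝ → E² → E²} {t : ℝ} {z : E²}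
    (hstat : ∀ᶠ s in 𝓝 t, Ψ₁ s = Ψ₁ t)
    (h₁ : DifferentiableAt ℝ (Ψ₁ t) (Ψ₂ t z)) (h₂t : DifferentiableAt ℝ (fun s => Ψ₂ s z) t)
    (h₂z : DifferentiableAt ℝ (Ψ₂ t) z)
    (hid : deriv (fun s => Ψ₂ s z) t + fderiv ℝ (Ψ₂ t) z (V t z) = 0) :
    deriv (fun s => Ψ₁ s (Ψ₂ s z)) t + fderiv ℝ (fun w => Ψ₁ t (Ψ₂ t w)) z (V t z) = 0 :=
  transport_comp_of_eventually_static hstat h₁ h₂t h₂z hid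

/-- **Pullback identity of a composite whose inner move has finished**: if the inner map
`Ψ₂(s,·) = Ψ₂(t,·)` is static near `t` and the outer pair `(Ψ₁, W)` satisfies the pullback identity
at `(t, Ψ₂(t,z))`, then `Ψ₁(s, Ψ₂(s,z))` satisfies it at `(t,z)` with any velocity `V` such that
`DΨ₂(t,z)[V(t,z)] = W(t, Ψ₂(t,z))` (for the moves of the quasi-self-similar construction `Ψ₂` acts
as a translation or the identity on the support of the later move, and `V = W ∘ Ψ₂`). [folklore] -/
theorem pullback_comp_of_inner_static {Ψ₁ Ψ₂ V W : ℝ → E² → E²} {t : ℝ} {z : E²}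
    (hstat : ∀ᶠ s in 𝓝 t, Ψ₂ s z = Ψ₂ t z)
    (h₁z : DifferentiableAt ℝ (Ψ₁ t) (Ψ₂ t z)) (h₂z : DifferentiableAt ℝ (Ψ₂ t) z)
    (hpush : fderiv ℝ (Ψ₂ t) z (V t z) = W t (Ψ₂ t z))
    (hid : deriv (fun s => Ψ₁ s (Ψ₂ t z)) t + fderiv ℝ (Ψ₁ t) (Ψ₂ t z) (W t (Ψ₂ t z)) = 0) :
    deriv (fun s => Ψ₁ s (Ψ₂ s z)) t + fderiv ℝ (fun w => Ψ₁ t (Ψ₂ t w)) z (V t z) = 0 := by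
  have he : (fun s => Ψ₁ s (Ψ₂ s z)) =ᶠ[𝓝 t] fun s => Ψ₁ s (Ψ₂ t z) :=
    hstat.mono fun s hs => by simp only [hs]
  have h2 : fderiv ℝ (fun w => Ψ₁ t (Ψ₂ t w)) z = (fderiv ℝ (Ψ₁ t) (Ψ₂ t z)).comp (fderiv ℝ (Ψ₂ t) z) :=
    fderiv_comp z h₁z h₂z
  rw [he.deriv_eq, h2, ContinuousLinearMap.comp_apply, hpush, hid]

/-! ## Shear moves -/

/-- **Horizontal shear, material coordinates**: the pullback map of the shear
`(x, y) ↦ (x + φ(t, y), y)` is `Ψ(t, (x, y)) = (x - φ(t, y), y)`. [folklore] -/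
def hShearPullback (φ : ℝ → ℝ → ℝ) (t : ℝ) (w : E²) : E² := vec2 (w 0 - φ t (w 1)) (w 1)

/-- **Horizontal shear, velocity**: `V(t, (x, y)) = (∂ₜφ(t, y), 0)` (the data `φt` is the time
derivative of the displacement profile). [folklore] -/
def hShearVelocity (φt : ℝ → ℝ → ℝ) (t : ℝ) (w : E²) : E² := vec2 (φt t (w 1)) 0

/-- Unfolding the horizontal shear pullback. [folklore] -/
@[simp]
theorem hShearPullback_apply (φ : ℝ → ℝ → ℝ) (t : ℝ) (w : E²) :
    hShearPullback φ t w = vec2 (w 0 - φ t (w 1)) (w 1) := rfl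

/-- Unfolding the horizontal shear velocity. [folklore] -/
@[simp]
theorem hShearVelocity_apply (φt : ℝ → ℝ → ℝ) (t : ℝ) (w : E²) :
    hShearVelocity φt t w = vec2 (φt t (w 1)) 0 := rfl

/-- At time parameters where the displacement vanishes the shear pullback is the identity.
[folklore] -/
theorem hShearPullback_eq_self {φ : ℝ → ℝ → ℝ} {t : ℝ} {w : E²} (h : φ t (w 1) = 0) :
    hShearPullback φ t w = w := by
  rw [hShearPullback_apply, h, sub_zero, vec2_apply_eq]

/-- **Pullback identity of the horizontal shear**: `∂ₜΨ + D_zΨ[V] = 0` at `(t, z)`, given that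
`φt(t, z₁)` is the time derivative of `φ(·, z₁)` at `t` and `φ(t, ·)` is differentiable at `z₁`.
(`∂ₜΨ = (-∂ₜφ, 0)`, `DΨ[V] = (V₀ - ∂_yφ V₁, V₁) = (∂ₜφ, 0)`.) [folklore] -/
theorem hShear_pullback_identity {φ φt : ℝ → ℝ → ℝ} {t φy : ℝ} {z : E²}
    (ht : HasDerivAt (fun s => φ s (z 1)) (φt t (z 1)) t) (hy : HasDerivAt (φ t) φy (z 1)) :
    deriv (fun s => hShearPullback φ s z) t +
      fderiv ℝ (hShearPullback φ t) z (hShearVelocity φt t z) = 0 := by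
  have hd : HasDerivAt (fun s => hShearPullback φ s z) (vec2 (0 - φt t (z 1)) 0) t := by
    simp only [hShearPullback_apply]
    exact hasDerivAt_vec2 ((hasDerivAt_const t (z 0)).sub ht) (hasDerivAt_const t (z 1))
  have hg : DifferentiableAt ℝ (uncurry fun a b : ℝ => a - φ t b) (z 0, z 1) :=
    differentiableAt_fst.sub (hy.differentiableAt.comp (z 0, z 1) differentiableAt_snd)
  have hP : HasFDerivAt (fun w : E² => w 0 - φ t (w 1))
      ((1 : ℝ) • (EuclideanSpace.proj (0 : Fin 2) : E² →L[ℝ] ℝ) +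
        (0 - φy) • (EuclideanSpace.proj (1 : Fin 2) : E² →L[ℝ] ℝ)) z :=
    hasFDerivAt_coordFun (g := fun a b : ℝ => a - φ t b) hg ((hasDerivAt_id (z 0)).sub_const _)
      ((hasDerivAt_const (z 1) (z 0)).sub hy)
  have hQ : HasFDerivAt (fun w : E² => w 1) (EuclideanSpace.proj (1 : Fin 2) : E² →L[ℝ] ℝ) z :=
    (EuclideanSpace.proj (1 : Fin 2) : E² →L[ℝ] ℝ).hasFDerivAt
  have hF := hasFDerivAt_vec2 hP hQ
  rw [hd.deriv, show hShearPullback φ t = fun w : E² => vec2 (w 0 - φ t (w 1)) (w 1) from rfl,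
    hF.fderiv, hShearVelocity_apply]
  simp only [_root_.add_apply, ContinuousLinearMap.smulRight_apply, _root_.smul_apply, smul_eq_mul]
  rw [show ((EuclideanSpace.proj (0 : Fin 2) : E² →L[ℝ] ℝ) (vec2 (φt t (z 1)) 0)) = φt t (z 1)
      from vec2_apply_zero _ _,
    show ((EuclideanSpace.proj (1 : Fin 2) : E² →L[ℝ] ℝ) (vec2 (φt t (z 1)) 0)) = 0
      from vec2_apply_one _ _]
  rw [show ∀ a b : ℝ, a • (EuclideanSpace.single 0 1 : E²) + b • (EuclideanSpace.single 1 1 : E²) =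
      vec2 a b from fun a b => rfl]
  rw [vec2_add_vec2, vec2_eq_zero_iff]
  constructor <;> ring

/-- **The horizontal shear velocity is divergence free** (it depends on `y` only and points
along `x`). [folklore] -/
theorem divergence_hShearVelocity {φt : ℝ → ℝ → ℝ} {t : ℝ} {z : E²}
    (hy : DifferentiableAt ℝ (φt t) (z 1)) :
    ∑ j, fderiv ℝ (hShearVelocity φt t) z (EuclideanSpace.single j 1) j = 0 := by
  have hP : HasFDerivAt (fun w : E² => φt t (w 1))
      (deriv (φt t) (z 1) • (EuclideanSpace.proj (1 : Fin 2) : E² →L[ℝ] ℝ)) z :=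
    hy.hasDerivAt.comp_hasFDerivAt z (EuclideanSpace.proj (1 : Fin 2) : E² →L[ℝ] ℝ).hasFDerivAt
  have hQ : HasFDerivAt (fun _ : E² => (0 : ℝ)) (0 : E² →L[ℝ] ℝ) z := hasFDerivAt_const 0 z
  rw [show hShearVelocity φt t = fun w => vec2 (φt t (w 1)) 0 from rfl, divergence_vec2 hP hQ]
  simp

/-- **Vertical shear, material coordinates**: `Ψ(t, (x, y)) = (x, y - φ(t, x))`. [folklore] -/
def vShearPullback (φ : ℝ → ℝ → ℝ) (t : ℝ) (w : E²) : E² := vec2 (w 0) (w 1 - φ t (w 0))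

/-- **Vertical shear, velocity**: `V(t, (x, y)) = (0, ∂ₜφ(t, x))`. [folklore] -/
def vShearVelocity (φt : ℝ → ℝ → ℝ) (t : ℝ) (w : E²) : E² := vec2 0 (φt t (w 0))

/-- Unfolding the vertical shear pullback. [folklore] -/
@[simp]
theorem vShearPullback_apply (φ : ℝ → ℝ → ℝ) (t : ℝ) (w : E²) :
    vShearPullback φ t w = vec2 (w 0) (w 1 - φ t (w 0)) := rfl

/-- Unfolding the vertical shear velocity. [folklore] -/
@[simp]
theorem vShearVelocity_apply (φt : ℝ → ℝ → ℝ) (t : ℝ) (w : E²) :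
    vShearVelocity φt t w = vec2 0 (φt t (w 0)) := rfl

/-- At time parameters where the displacement vanishes the vertical shear pullback is the
identity. [folklore] -/
theorem vShearPullback_eq_self {φ : ℝ → ℝ → ℝ} {t : ℝ} {w : E²} (h : φ t (w 0) = 0) :
    vShearPullback φ t w = w := by
  rw [vShearPullback_apply, h, sub_zero, vec2_apply_eq]

/-- **Pullback identity of the vertical shear**: `∂ₜΨ + D_zΨ[V] = 0` at `(t, z)`.
(`∂ₜΨ = (0, -∂ₜφ)`, `DΨ[V] = (V₀, V₁ - ∂ₓφ V₀) = (0, ∂ₜφ)`.) [folklore] -/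
theorem vShear_pullback_identity {φ φt : ℝ → ℝ → ℝ} {t φx : ℝ} {z : E²}
    (ht : HasDerivAt (fun s => φ s (z 0)) (φt t (z 0)) t) (hx : HasDerivAt (φ t) φx (z 0)) :
    deriv (fun s => vShearPullback φ s z) t +
      fderiv ℝ (vShearPullback φ t) z (vShearVelocity φt t z) = 0 := by
  have hd : HasDerivAt (fun s => vShearPullback φ s z) (vec2 0 (0 - φt t (z 0))) t := by
    simp only [vShearPullback_apply]
    exact hasDerivAt_vec2 (hasDerivAt_const t (z 0)) ((hasDerivAt_const t (z 1)).sub ht)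
  have hg : DifferentiableAt ℝ (uncurry fun a b : ℝ => b - φ t a) (z 0, z 1) :=
    differentiableAt_snd.sub (hx.differentiableAt.comp (z 0, z 1) differentiableAt_fst)
  have hQ : HasFDerivAt (fun w : E² => w 1 - φ t (w 0))
      ((0 - φx) • (EuclideanSpace.proj (0 : Fin 2) : E² →L[ℝ] ℝ) +
        (1 : ℝ) • (EuclideanSpace.proj (1 : Fin 2) : E² →L[ℝ] ℝ)) z :=
    hasFDerivAt_coordFun (g := fun a b : ℝ => b - φ t a) hg ((hasDerivAt_const (z 0) (z 1)).sub hx)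
      ((hasDerivAt_id (z 1)).sub_const _)
  have hP : HasFDerivAt (fun w : E² => w 0) (EuclideanSpace.proj (0 : Fin 2) : E² →L[ℝ] ℝ) z :=
    (EuclideanSpace.proj (0 : Fin 2) : E² →L[ℝ] ℝ).hasFDerivAt
  have hF := hasFDerivAt_vec2 hP hQ
  rw [hd.deriv, show vShearPullback φ t = fun w : E² => vec2 (w 0) (w 1 - φ t (w 0)) from rfl,
    hF.fderiv, vShearVelocity_apply]
  simp only [_root_.add_apply, ContinuousLinearMap.smulRight_apply, _root_.smul_apply, smul_eq_mul]
  rw [show ((EuclideanSpace.proj (0 : Fin 2) : E² →L[ℝ] ℝ) (vec2 0 (φt t (z 0)))) = 0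
      from vec2_apply_zero _ _,
    show ((EuclideanSpace.proj (1 : Fin 2) : E² →L[ℝ] ℝ) (vec2 0 (φt t (z 0)))) = φt t (z 0)
      from vec2_apply_one _ _]
  rw [show ∀ a b : ℝ, a • (EuclideanSpace.single 0 1 : E²) + b • (EuclideanSpace.single 1 1 : E²) =
      vec2 a b from fun a b => rfl]
  rw [vec2_add_vec2, vec2_eq_zero_iff]
  constructor <;> ring

/-- **The vertical shear velocity is divergence free**. [folklore] -/
theorem divergence_vShearVelocity {φt : ℝ → ℝ → ℝ} {t : ℝ} {z : E²}
    (hx : DifferentiableAt ℝ (φt t) (z 0)) :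
    ∑ j, fderiv ℝ (vShearVelocity φt t) z (EuclideanSpace.single j 1) j = 0 := by
  have hQ : HasFDerivAt (fun w : E² => φt t (w 0))
      (deriv (φt t) (z 0) • (EuclideanSpace.proj (0 : Fin 2) : E² →L[ℝ] ℝ)) z :=
    hx.hasDerivAt.comp_hasFDerivAt z (EuclideanSpace.proj (0 : Fin 2) : E² →L[ℝ] ℝ).hasFDerivAt
  have hP : HasFDerivAt (fun _ : E² => (0 : ℝ)) (0 : E² →L[ℝ] ℝ) z := hasFDerivAt_const 0 z
  rw [show vShearVelocity φt t = fun w => vec2 0 (φt t (w 0)) from rfl, divergence_vec2 hP hQ]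
  simp

/-! ## Axial stretch moves

A time-dependent family of one-dimensional reparametrisations `x ↦ Ξ(t, x)` (increasing in
`x`) of the axis `{y = c}`, extended to the plane with the transverse compensation that makes the
material map area preserving: `Ψ(t, (x, y)) = (Ξ(t, x), c + (y - c)/∂ₓΞ(t, x))` (Jacobian
`∂ₓΞ · (∂ₓΞ)⁻¹ = 1`). Its Eulerian velocity is the stream-function field
`V = ∇⊥(g(t,x)(y - c)) = (g, -(y - c) ∂ₓg)` with `g = -∂ₜΞ/∂ₓΞ`. This is the move that thins a
straight channel near a gate while stretching it along its axis (the gate squeeze), and, with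
`Ξ(t, ·)` affine of slope `λ(t)` near a point, the local hyperbolic squeeze `(λx, y/λ)`. The data
are the partial derivatives of `Ξ` as explicit functions, so that closed forms can be supplied.
-/

/-- **Axial stretch, material coordinates**: `Ψ(t, (x, y)) = (Ξ(t, x), c + (y - c)/Ξₓ(t, x))`
(`Ξx` is the datum for `∂ₓΞ`). [folklore] -/
def axialPullback (Ξ Ξx : ℝ → ℝ → ℝ) (c : ℝ) (t : ℝ) (w : E²) : E² :=
  vec2 (Ξ t (w 0)) (c + (w 1 - c) / Ξx t (w 0))

/-- **Axial stretch, Eulerian rate**: `g(t, x) = -∂ₜΞ(t, x)/∂ₓΞ(t, x)`. [folklore] -/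
def axialRate (Ξx Ξt : ℝ → ℝ → ℝ) (t x : ℝ) : ℝ := -Ξt t x / Ξx t x

/-- **The `x`-derivative of the Eulerian rate** in closed form:
`∂ₓg = -(Ξₓₜ Ξₓ - Ξₜ Ξₓₓ)/Ξₓ²`. [folklore] -/
def axialRateDeriv (Ξx Ξt Ξxx Ξxt : ℝ → ℝ → ℝ) (t x : ℝ) : ℝ :=
  -(Ξxt t x * Ξx t x - Ξt t x * Ξxx t x) / Ξx t x ^ 2

/-- **Axial stretch, velocity**: `V(t, (x, y)) = (g(t, x), -(y - c) ∂ₓg(t, x))`, the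
stream-function field of `ψ = g(t, x)(y - c)`; the data are `g` and `∂ₓg`. [folklore] -/
def axialVelocity (g gx : ℝ → ℝ → ℝ) (c : ℝ) (t : ℝ) (w : E²) : E² :=
  vec2 (g t (w 0)) (-(w 1 - c) * gx t (w 0))

/-- Unfolding the axial pullback. [folklore] -/
@[simp]
theorem axialPullback_apply (Ξ Ξx : ℝ → ℝ → ℝ) (c t : ℝ) (w : E²) :
    axialPullback Ξ Ξx c t w = vec2 (Ξ t (w 0)) (c + (w 1 - c) / Ξx t (w 0)) := rfl

/-- Unfolding the axial velocity. [folklore] -/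
@[simp]
theorem axialVelocity_apply (g gx : ℝ → ℝ → ℝ) (c t : ℝ) (w : E²) :
    axialVelocity g gx c t w = vec2 (g t (w 0)) (-(w 1 - c) * gx t (w 0)) := rfl

/-- Where `Ξ(t, ·)` is the identity to first order (`Ξ(t, x) = x`, `Ξₓ(t, x) = 1`) the axial
pullback fixes the point. [folklore] -/
theorem axialPullback_eq_self {Ξ Ξx : ℝ → ℝ → ℝ} {c t : ℝ} {w : E²} (h : Ξ t (w 0) = w 0)
    (hx : Ξx t (w 0) = 1) : axialPullback Ξ Ξx c t w = w := by
  rw [axialPullback_apply, h, hx, div_one, add_sub_cancel, vec2_apply_eq]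

/-- On the axis `{y = c}` the axial pullback is the one-dimensional map: `Ψ(t, (x, c)) = (Ξ(t,x), c)`.
[folklore] -/
theorem axialPullback_apply_axis {Ξ Ξx : ℝ → ℝ → ℝ} {c t : ℝ} {w : E²} (h : w 1 = c) :
    axialPullback Ξ Ξx c t w = vec2 (Ξ t (w 0)) c := by
  rw [axialPullback_apply, h, sub_self, zero_div, add_zero]

/-- Where the rate vanishes (`Ξₜ(t, x) = 0`: nothing moves on the line `{x} × ℝ` at time `t`)
the axial velocity has vanishing first component; if moreover `∂ₓg(t,x) = 0` it vanishes.
[folklore] -/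
theorem axialVelocity_eq_zero {g gx : ℝ → ℝ → ℝ} {c t : ℝ} {w : E²} (h : g t (w 0) = 0)
    (hx : gx t (w 0) = 0) : axialVelocity g gx c t w = 0 := by
  rw [axialVelocity_apply, h, hx, mul_zero, vec2_eq_zero_iff]
  exact ⟨rfl, rfl⟩

/-- **Derivative of the Eulerian rate**: `∂ₓ(-Ξₜ/Ξₓ) = -(Ξₓₜ Ξₓ - Ξₜ Ξₓₓ)/Ξₓ²`, given the
`x`-derivatives `Ξₓₜ` of `Ξₜ(t, ·)` and `Ξₓₓ` of `Ξₓ(t, ·)` at `x` and `Ξₓ(t, x) ≠ 0`. [folklore] -/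
theorem hasDerivAt_axialRate {Ξx Ξt Ξxx Ξxt : ℝ → ℝ → ℝ} {t x : ℝ}
    (htx : HasDerivAt (Ξt t) (Ξxt t x) x) (hxx : HasDerivAt (Ξx t) (Ξxx t x) x)
    (hne : Ξx t x ≠ 0) :
    HasDerivAt (axialRate Ξx Ξt t) (axialRateDeriv Ξx Ξt Ξxx Ξxt t x) x := by
  have h : HasDerivAt (fun y => -Ξt t y / Ξx t y)
      ((-Ξxt t x * Ξx t x - -Ξt t x * Ξxx t x) / Ξx t x ^ 2) x := (htx.neg).div hxx hne
  show HasDerivAt (fun y => -Ξt t y / Ξx t y) _ x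
  refine h.congr_deriv ?_
  unfold axialRateDeriv
  ring

/-- **Pullback identity of the axial stretch**: with `Ξₜ`, `Ξₓ`, `Ξₓₓ`, `Ξₓₜ` the indicated
partial derivatives of `Ξ` at `(t, z₀)` (`Ξₓₜ` = the time derivative of `Ξₓ(·, z₀)`; by symmetry
of second derivatives it is also the `x`-derivative of `Ξₜ(t, ·)`, which is how it enters the
velocity) and `Ξₓ(t, z₀) ≠ 0`, the pair (`axialPullback`, `axialVelocity` of the rate
`g = -Ξₜ/Ξₓ` and its `x`-derivative) satisfies `∂ₜΨ + D_zΨ[V] = 0` at `(t, z)`. First component: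
`Ξₜ + Ξₓ g = 0`; second component:
`(y-c)[-Ξₓₜ/Ξₓ² + (Ξₓₓ/Ξₓ²)(Ξₜ/Ξₓ) + (Ξₓₜ Ξₓ - Ξₜ Ξₓₓ)/Ξₓ³] = 0`. [folklore] -/
theorem axial_pullback_identity {Ξ Ξx Ξt Ξxx Ξxt : ℝ → ℝ → ℝ} {c t : ℝ} {z : E²}
    (ht : HasDerivAt (fun s => Ξ s (z 0)) (Ξt t (z 0)) t)
    (hx : HasDerivAt (Ξ t) (Ξx t (z 0)) (z 0))
    (hxx : HasDerivAt (Ξx t) (Ξxx t (z 0)) (z 0))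
    (hxt : HasDerivAt (fun s => Ξx s (z 0)) (Ξxt t (z 0)) t)
    (hne : Ξx t (z 0) ≠ 0) :
    deriv (fun s => axialPullback Ξ Ξx c s z) t +
      fderiv ℝ (axialPullback Ξ Ξx c t) z
        (axialVelocity (axialRate Ξx Ξt) (axialRateDeriv Ξx Ξt Ξxx Ξxt) c t z) = 0 := by
  -- abbreviations for the values of the data at the point
  set X := Ξx t (z 0) with hX
  set T := Ξt t (z 0) with hT
  set XX := Ξxx t (z 0) with hXX
  set XT := Ξxt t (z 0) with hXT
  -- time derivative of the pullback
  have hinvt : HasDerivAt (fun s => (Ξx s (z 0))⁻¹) (-XT / X ^ 2) t := hxt.fun_inv hne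
  have hd : HasDerivAt (fun s => axialPullback Ξ Ξx c s z)
      (vec2 T (0 + (z 1 - c) * (-XT / X ^ 2))) t := by
    simp only [axialPullback_apply, div_eq_mul_inv]
    exact hasDerivAt_vec2 ht ((hasDerivAt_const t c).add (hinvt.const_mul (z 1 - c)))
  -- space derivative of the pullback
  have hinvx : HasDerivAt (fun a => (Ξx t a)⁻¹) (-XX / X ^ 2) (z 0) := hxx.fun_inv hne
  have hgP : DifferentiableAt ℝ (uncurry fun a _ : ℝ => Ξ t a) (z 0, z 1) :=
    hx.differentiableAt.comp (z 0, z 1) differentiableAt_fst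
  have hP : HasFDerivAt (fun w : E² => Ξ t (w 0))
      (X • (EuclideanSpace.proj (0 : Fin 2) : E² →L[ℝ] ℝ) +
        (0 : ℝ) • (EuclideanSpace.proj (1 : Fin 2) : E² →L[ℝ] ℝ)) z :=
    hasFDerivAt_coordFun (g := fun a _ : ℝ => Ξ t a) hgP hx (hasDerivAt_const (z 1) _)
  have hgQ : DifferentiableAt ℝ (uncurry fun a b : ℝ => c + (b - c) * (Ξx t a)⁻¹) (z 0, z 1) := by
    have h1 : DifferentiableAt ℝ (fun p : ℝ × ℝ => Ξx t p.1) (z 0, z 1) :=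
      hxx.differentiableAt.comp (z 0, z 1) differentiableAt_fst
    exact (differentiableAt_const c).add
      ((differentiableAt_snd.sub_const c).mul (h1.fun_inv hne))
  have hQ : HasFDerivAt (fun w : E² => c + (w 1 - c) * (Ξx t (w 0))⁻¹)
      ((0 + (z 1 - c) * (-XX / X ^ 2)) • (EuclideanSpace.proj (0 : Fin 2) : E² →L[ℝ] ℝ) +
        (0 + 1 * X⁻¹) • (EuclideanSpace.proj (1 : Fin 2) : E² →L[ℝ] ℝ)) z :=
    hasFDerivAt_coordFun (g := fun a b : ℝ => c + (b - c) * (Ξx t a)⁻¹) hgQ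
      ((hasDerivAt_const (z 0) c).add (hinvx.const_mul (z 1 - c)))
      ((hasDerivAt_const (z 1) c).add (((hasDerivAt_id (z 1)).sub_const c).mul_const X⁻¹))
  have hF := hasFDerivAt_vec2 hP hQ
  have hfun : axialPullback Ξ Ξx c t = fun w => vec2 (Ξ t (w 0)) (c + (w 1 - c) * (Ξx t (w 0))⁻¹) := by
    funext w; rw [axialPullback_apply, div_eq_mul_inv]
  -- the velocity at the point
  have hV : axialVelocity (axialRate Ξx Ξt) (axialRateDeriv Ξx Ξt Ξxx Ξxt) c t z =
      vec2 (-T / X) (-(z 1 - c) * (-(XT * X - T * XX) / X ^ 2)) := rfl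
  rw [hd.deriv, hfun, hF.fderiv, hV]
  simp only [_root_.add_apply, ContinuousLinearMap.smulRight_apply, _root_.smul_apply, smul_eq_mul]
  rw [show ((EuclideanSpace.proj (0 : Fin 2) : E² →L[ℝ] ℝ)
      (vec2 (-T / X) (-(z 1 - c) * (-(XT * X - T * XX) / X ^ 2)))) = -T / X from vec2_apply_zero _ _,
    show ((EuclideanSpace.proj (1 : Fin 2) : E² →L[ℝ] ℝ)
      (vec2 (-T / X) (-(z 1 - c) * (-(XT * X - T * XX) / X ^ 2)))) =
        -(z 1 - c) * (-(XT * X - T * XX) / X ^ 2) from vec2_apply_one _ _]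
  rw [show ∀ a b : ℝ, a • (EuclideanSpace.single 0 1 : E²) + b • (EuclideanSpace.single 1 1 : E²) =
      vec2 a b from fun a b => rfl]
  rw [vec2_add_vec2, vec2_eq_zero_iff]
  constructor
  · field_simp
    ring
  · field_simp
    ring

/-- **The axial velocity is divergence free**: `∂ₓg + ∂_y(-(y - c)∂ₓg) = 0`, given that `gx(t,·)`
is the derivative of `g(t,·)` at `z₀` and is itself differentiable there. [folklore] -/
theorem divergence_axialVelocity {g gx : ℝ → ℝ → ℝ} {c t : ℝ} {z : E²}
    (hg : HasDerivAt (g t) (gx t (z 0)) (z 0)) (hgx : DifferentiableAt ℝ (gx t) (z 0)) :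
    ∑ j, fderiv ℝ (axialVelocity g gx c t) z (EuclideanSpace.single j 1) j = 0 := by
  have hP : HasFDerivAt (fun w : E² => g t (w 0))
      (gx t (z 0) • (EuclideanSpace.proj (0 : Fin 2) : E² →L[ℝ] ℝ)) z :=
    hg.comp_hasFDerivAt z (EuclideanSpace.proj (0 : Fin 2) : E² →L[ℝ] ℝ).hasFDerivAt
  have hgQ : DifferentiableAt ℝ (uncurry fun a b : ℝ => -(b - c) * gx t a) (z 0, z 1) :=
    (differentiableAt_snd.sub_const c).neg.mul (hgx.comp (z 0, z 1) differentiableAt_fst)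
  have hQ : HasFDerivAt (fun w : E² => -(w 1 - c) * gx t (w 0))
      ((-(z 1 - c) * deriv (gx t) (z 0)) • (EuclideanSpace.proj (0 : Fin 2) : E² →L[ℝ] ℝ) +
        (-(1 : ℝ) * gx t (z 0)) • (EuclideanSpace.proj (1 : Fin 2) : E² →L[ℝ] ℝ)) z :=
    hasFDerivAt_coordFun (g := fun a b : ℝ => -(b - c) * gx t a) hgQ
      (hgx.hasDerivAt.const_mul _) (((hasDerivAt_id (z 1)).sub_const c).neg.mul_const _)
  rw [show axialVelocity g gx c t = fun w => vec2 (g t (w 0)) (-(w 1 - c) * gx t (w 0)) from rfl,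
    divergence_vec2 hP hQ]
  simp

end PlanarKinematics

end Literature.Analysis.FluidPDE
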